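import Summits.BirchSwinnertonDyer.BirchSwinnertonDyer.Theorems.KolyvaginRoadThreeMethod2TransLocal
import Summits.BirchSwinnertonDyer.BirchSwinnertonDyer.Theorems.KolyvaginRoadThreeMethod2LocalInputsLineTrans
import Literature.NumberTheory.EllipticCurves.RingClassFieldFrobenius
import Literature.NumberTheory.GaloisRepresentations.FrobeniusGeneration
import HarnessLib

/-!
# KOLY method line, crux stmt-BirchSwinnertonDyer-19574 `ZhangSharpFrameAtThreeHL`, stub S2-ENGINE: the LOCAL GALOIS
# PICTURE AT A KOLYVAGIN PRIME `λ = (ℓ)` of the Hoffstein–Luo frame — the decomposition group acts TRIVIALLY on `E[3]`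
# and on the (embedded) Hilbert class field `K[1]`
# (cell `bsd-stepL`, seat `bsd-stepL-zhang3-p1` g9; `--supports 19574`, helper; inputs of (Tr-iso) ∕ (Line) ∕ (Perf))

HONEST FRAMING. Theorems only (0 definitions, 0 named facts, 0 `sorry`); nothing about Heegner points; closes nothing
(T7). PARTITION: O2@3 (B10) × A1 × crux 19574 × stub S2-ENGINE — types-the-object-of (local inputs of the
Kolyvagin-prime package of `Method2.triangulation_of_kolyvaginLocal`).

WHAT. `K` imaginary quadratic, `E = W/ℚ` globally minimal, `ℓ` a Kolyvagin prime of W. Zhang at `p = 3`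
(`Zhang2014.IsKolyvaginPrime N W K 3 ℓ`: `ℓ ∤ 3 N d_K` prime, `(ℓ)` prime in `𝓞 K`, `3 ∣ ℓ + 1`, `3 ∣ a_ℓ`), `w = λ`
the place above `ℓ`, `𝔓 = 𝔓_{ι₀,𝔐}` the prime of `\bar ℤ_K` cut out by the chosen embedding `K̄ → K̄_λ`
(so that `G_𝔓 = res Γ_{K_λ}`).
* §A `frob_sq_smul_eq_self` — CAYLEY–HAMILTON AT A KOLYVAGIN PRIME: for a `ℚ`-Frobenius `h` at a prime above `ℓ`,
  `h² = 1` on `E[3](ℚ̄)` (`tr = a_ℓ ≡ 0`, `det = ℓ ≡ −1 (mod 3)`; Gross (3.3) ⟸ "`Frob ℓ = τ` on `E[p]`").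
* §B `exists_frobenius_trivial` — a `K`-Frobenius `F` at `𝔓` acting TRIVIALLY on `E(K̄)[3]` (`res F = j·h²`, `j`
  inert acting trivially by good reduction at `ℓ ≠ 3`; Neukirch I (9.4), Silverman VII.4.1) — "`λ` splits completely
  in `K(E[3])`".
* §C `hasGoodReductionAt_of_kolyvagin` — `E/K` has good reduction at `λ`, `λ ∤ 3`.
* §D `smul_torsion_eq_self_of_mem_decompositionSubgroup` — the WHOLE decomposition group `G_𝔓` fixes `E(K̄)[3]`
  (`G_𝔓 = ⟨F⟩·I_𝔓·Γ_{K(E[3])}`, inertia trivial by good reduction).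
* §E `smul_ringClassFieldOne_eq_self_of_mem_decompositionSubgroup` — `G_𝔓` fixes every `K`-embedded copy of the
  Hilbert class field `K[1]` in `K̄` ("`λ = (ℓ)` is principal, so splits completely in `K[1]`", Gross §3 ∕ tree
  `mem_splitPrimes_ringClassField_of_span_natCast`; Frobenius elements above split primes fix the field, inertia
  elements are quotients of two Frobenius elements, and `G_𝔓` is generated by a Frobenius, the inertia and any open
  subgroup).
These are the inputs of the transverse isotropy (Tr-iso), of (Line) and of (Perf) at Kolyvagin primes.

References: [cite: GrossLMS1991, §3 (3.1)–(3.3), §4, Prop. 9.6] [cite: WZhang2014, Notations (xii), §8.1]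
[cite: NeukirchANT1999, Ch. I §9 Prop. (9.4)–(9.6)] [cite: SilvermanAEC2009, Prop. VII.4.1] [cite: Marcus2018, Ch. 4,
remark after Thm. 32].
-/

noncomputable section

open scoped Classical Pointwise
open Polynomial

namespace Summit.BirchSwinnertonDyer.Rank1Residual.X11b.Three.Koly.Method2.KolyLocal

open WeierstrassCurve Field Function NumberField IsDedekindDomain Rat.HeightOneSpectrum
open Literature.NumberTheory.EllipticCurves Literature.NumberTheory.GaloisRepresentations Module
open Summit.BirchSwinnertonDyer.Rank1Residual.X11b.Three.Koly.Method2

/-! ## §A Cayley–Hamilton at a Kolyvagin prime: `Frob_ℓ² = 1` on `E[3](ℚ̄)` -/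

section Rational

variable {k : Type*} [Field k] {V : Type*} [AddCommGroup V] [Module k V] [FiniteDimensional k V]

/-- On a `2`-dimensional space the characteristic polynomial of an endomorphism `f` is `X² − tr(f) X + det(f)`
(a private copy of koly g13's lemma in `…Method2TransLocal`). [folklore] -/
private theorem charpoly_eq_of_finrank_eq_two (h2 : Module.finrank k V = 2) (f : Module.End k V) :
    f.charpoly = X ^ 2 - C (LinearMap.trace k V f) * X + C (LinearMap.det f) := by
  let b := Module.finBasisOfFinrankEq k V h2
  rw [← LinearMap.charpoly_toMatrix f b, Matrix.charpoly_fin_two,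
    ← LinearMap.trace_eq_matrix_trace k b f, LinearMap.det_toMatrix b f]

/-- Cayley–Hamilton in dimension `2`, pointwise: `f (f x) = tr(f) • f x - det(f) • x`. [folklore] -/
private theorem apply_apply_eq_of_finrank_eq_two (h2 : Module.finrank k V = 2) (f : Module.End k V) (x : V) :
    f (f x) = LinearMap.trace k V f • f x - LinearMap.det f • x := by
  have hCH := LinearMap.aeval_self_charpoly f
  rw [charpoly_eq_of_finrank_eq_two h2, map_add, map_sub, map_mul, aeval_C, aeval_C, map_pow, aeval_X] at hCH
  have h := congrArg (fun g : Module.End k V => g x) hCH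
  simp only [LinearMap.add_apply, LinearMap.sub_apply, LinearMap.zero_apply, Module.End.mul_apply,
    pow_two, Module.algebraMap_end_apply] at h
  rw [sub_add_eq_add_sub, sub_eq_zero] at h
  rw [eq_sub_iff_add_eq]
  rw [← h]

variable (W : WeierstrassCurve ℚ) [W.IsElliptic] [W.IsGloballyMinimal]

/-- **§A. `Frob_ℓ² = 1` on `E[3](ℚ̄)` at a Kolyvagin prime.** For `W/ℚ` in global minimal form, a prime `ℓ ≠ 3` of
good reduction with `3 ∣ ℓ + 1` and `3 ∣ a_ℓ`, a place `v` of `ℚ` at `ℓ`, a prime `𝔓 ∣ v` of `\bar ℤ` and an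
arithmetic Frobenius `h` at `𝔓`: `h (h P) = P` for every `P ∈ E[3](ℚ̄)`. Cayley–Hamilton on the `𝔽₃`-plane `E[3]`
with `tr = a_ℓ ≡ 0`, `det = ℓ ≡ −1`: `h² = tr·h − det = 1`. This is the converse half of Gross's remark that (3.2)
`Frob(ℓ) = Frob(∞)` on `ℚ(E_p)` is equivalent to (3.3) `a_ℓ ≡ ℓ + 1 ≡ 0 (mod p)`, in the only form used below.
[cite: GrossLMS1991, §3 (3.2)–(3.3)] [cite: Serre1981, §8.1 eq. (238)] -/
theorem frob_sq_smul_eq_self {ℓ : ℕ} [Fact ℓ.Prime] (hℓ3 : ℓ ≠ 3) (hgood : W.HasGoodReductionAtPrime ℓ)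
    (hℓ1 : 3 ∣ ℓ + 1) (ha : (3 : ℤ) ∣ W.frobeniusTrace ℓ)
    {v : HeightOneSpectrum (𝓞 ℚ)} (hv : (primesEquiv v : ℕ) = ℓ)
    {𝔓 : Ideal (absIntegers (𝓞 ℚ) ℚ)} (h𝔓 : 𝔓 ∈ v.primesAbove)
    {h : absoluteGaloisGroup ℚ} (hh : IsArithFrobAt (𝓞 ℚ) h 𝔓) (P : geomTorsion W (3 : ℕ)) :
    h • h • P = P := by
  haveI : Fact (Nat.Prime 3) := ⟨Nat.prime_three⟩
  letI : Module (ZMod 3) (geomTorsion W (3 : ℕ)) := AddSubgroup.torsionBy.zmodModule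
  set f := (galoisRepTorsion W 3 h).toAdd.toAddMonoidHom.toZModLinearMap 3 with hfdef
  have hf : ∀ Q : geomTorsion W (3 : ℕ), f Q = h • Q := fun Q => rfl
  have htr : LinearMap.trace (ZMod 3) _ f = (W.frobeniusTrace ℓ : ZMod 3) :=
    W.trace_galoisRepTorsion_frobenius_eq 3 hℓ3 hgood hv h𝔓 hh
  have hdet : LinearMap.det f = (ℓ : ZMod 3) := W.det_galoisRepTorsion_frobenius_eq 3 hℓ3 hgood hv h𝔓 hh
  have h2 : Module.finrank (ZMod 3) (geomTorsion W (3 : ℕ)) = 2 :=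
    Literature.RepresentationTheory.FiniteGroups.Representation.finrank_eq_two_of_natCard_eq_sq
      (card_torsionPoints_eq_sq_holds W (AlgebraicClosure ℚ) (n := 3) (by norm_num))
  -- `a_ℓ ≡ 0`, `ℓ ≡ −1 (mod 3)`
  have ha0 : (W.frobeniusTrace ℓ : ZMod 3) = 0 := by
    rw [ZMod.intCast_zmod_eq_zero_iff_dvd]; exact ha
  have hℓm : (ℓ : ZMod 3) = -1 := by
    have h3 : ((ℓ + 1 : ℕ) : ZMod 3) = 0 := by
      rw [ZMod.natCast_eq_zero_iff]; exact hℓ1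
    rw [Nat.cast_add, Nat.cast_one] at h3
    exact eq_neg_of_add_eq_zero_left h3
  haveI : FiniteDimensional (ZMod 3) (geomTorsion W (3 : ℕ)) := Module.finite_of_finrank_eq_succ h2
  -- Cayley–Hamilton: `f (f P) = a • f P − ℓ • P = P`
  have hff : f (f P) = P := by
    rw [apply_apply_eq_of_finrank_eq_two h2 f P]
    erw [htr, hdet]
    rw [ha0, hℓm, zero_smul, neg_smul, one_smul, zero_sub, neg_neg]
  simpa only [hf] using hff

end Rational

/-! ## §B–§D The Frobenius and the decomposition group at `λ` act trivially on `E(K̄)[3]` -/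

section Local

variable (W : WeierstrassCurve ℚ) (K : Type) [Field K] [NumberField K] [W.IsElliptic] [W.IsGloballyMinimal]

/-- **§C. The place above a Kolyvagin prime is a place of good reduction of `E/K`, not above `3`** (`ℓ ∤ N`, `ℓ ≠ 3`).
[folklore] -/
theorem hasGoodReductionAt_of_kolyvagin {ℓ : ℕ} (hℓ : Zhang2014.IsKolyvaginPrime (W.conductorNorm ℤ) W K 3 ℓ)
    (w : HeightOneSpectrum (𝓞 K)) (hw : (ℓ : 𝓞 K) ∈ w.asIdeal) :
    (W.baseChange K).HasGoodReductionAt w ∧ ((((3 ^ 1 : ℕ) : ℤ) : 𝓞 K) ∉ w.asIdeal) := by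
  obtain ⟨hℓprime, hℓN, -, hℓ3, -, -⟩ := hℓ
  have hℓw : (ℓ : 𝓞 ℚ) ∈ (w.under (𝓞 ℚ)).asIdeal := by
    change (ℓ : 𝓞 ℚ) ∈ w.asIdeal.under (𝓞 ℚ)
    rw [Ideal.under_def, Ideal.mem_comap, map_natCast]; exact hw
  haveI : w.asIdeal.LiesOver (w.under (𝓞 ℚ)).asIdeal := ⟨rfl⟩
  refine ⟨hasGoodReductionAt_baseChange_of_hasGoodReductionAt_rat W (w.under (𝓞 ℚ)) w
      (LocalFrob.hasGoodReductionAt_rat_of_not_dvd_conductorNorm W hℓprime hℓN _ hℓw), ?_⟩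
  rw [Int.cast_natCast]
  exact not_mem_asIdeal_of_coprime K ((Nat.coprime_primes hℓprime Nat.prime_three).mpr hℓ3) w hw

/-- **§B. A Frobenius at `λ` acting trivially on `E(K̄)[3]`.** `K` imaginary quadratic, `ℓ` a Kolyvagin prime at `3`,
`w ∋ ℓ` its place, `𝔐` a prime of `\bar 𝓞_w` above `𝓂_w`: there is an arithmetic `K`-Frobenius `F` at the prime
`𝔓_{ι₀,𝔐}` of `\bar ℤ_K` cut out by the chosen embedding `ι₀ : K̄ → K̄_w`, and `F` acts TRIVIALLY on `E(K̄)[3]`: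
`res F = j·h'²` with `h'` a `ℚ`-Frobenius above `ℓ` (`h'² = 1` on `E[3](ℚ̄)`, §A) and `j` in the inertia group,
trivial on `E[3]` by good reduction at `ℓ ≠ 3` (Silverman VII.4.1), transported along `E[3](ℚ̄) ≃ E[3](K̄)`. So `λ`
splits completely in `K(E[3])` (Gross §3: `Frob λ = τ² = 1` on `E_p`). [cite: GrossLMS1991, §3 (3.2)–(3.3), §4]
[cite: NeukirchANT1999, Ch. I §9 Prop. (9.4)] [cite: SilvermanAEC2009, Prop. VII.4.1] -/
theorem exists_frobenius_trivial (hK : IsImaginaryQuadratic K) {ℓ : ℕ}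
    (hℓ : Zhang2014.IsKolyvaginPrime (W.conductorNorm ℤ) W K 3 ℓ) (w : HeightOneSpectrum (𝓞 K))
    (hw : (ℓ : 𝓞 K) ∈ w.asIdeal) {𝔐 : Ideal w.localAbsIntegers} (h𝔐 : 𝔐 ∈ w.localPrimesAbove) :
    ∃ F : absoluteGaloisGroup K,
      IsArithFrobAt (𝓞 K) F (w.primeBelow (closureEmb (K := K) (w.adicCompletion K)) 𝔐) ∧
      ∀ Q : geomTorsion (W.baseChange K) ((3 ^ 1 : ℕ) : ℤ), F • Q = Q := by
  haveI : Algebra.IsQuadraticExtension ℚ K := ⟨hK.1⟩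
  haveI : Fact (Nat.Prime 3) := ⟨Nat.prime_three⟩
  have hℓp : ℓ.Prime := hℓ.1
  haveI : Fact ℓ.Prime := ⟨hℓp⟩
  have hℓ3 : ℓ ≠ 3 := hℓ.2.2.2.1
  have hℓP : (Ideal.span {(ℓ : 𝓞 K)}).IsPrime := hℓ.2.2.2.2.1
  have hdvd := Zhang2014.IsKolyvaginPrime.dvd (p := 3) hℓ
  -- ### the place `v₁` of `ℚ` below `w`; good reduction at `ℓ ∤ N`
  set v₁ : HeightOneSpectrum (𝓞 ℚ) := w.under (𝓞 ℚ) with hv₁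
  have hwv₁ : w.asIdeal.under (𝓞 ℚ) = v₁.asIdeal := rfl
  have hℓv₁ : (ℓ : 𝓞 ℚ) ∈ v₁.asIdeal := by
    rw [← hwv₁, Ideal.under_def, Ideal.mem_comap, map_natCast]
    exact hw
  have hv₁ℓ : (primesEquiv v₁ : ℕ) = ℓ := primesEquiv_eq_of_natCast_mem hℓp hℓv₁
  have hgood₁ : W.HasGoodReductionAt v₁ := LocalFrob.hasGoodReductionAt_rat_of_not_dvd_conductorNorm W hℓp hℓ.2.1 v₁ hℓv₁
  have hgood : W.HasGoodReductionAtPrime ℓ := (hasGoodReductionAtPrime_primesEquiv_iff_holds W v₁ ℓ hv₁ℓ).mpr hgood₁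
  -- ### the primes `𝔓 ∣ w` and `𝔓' = 𝔓 ∩ \bar ℤ ∣ v₁`
  set ι₀ := closureEmb (K := K) (w.adicCompletion K) with hι₀
  set 𝔓 := w.primeBelow ι₀ 𝔐 with h𝔓def
  have h𝔓 : 𝔓 ∈ w.primesAbove := HeightOneSpectrum.primeBelow_mem_primesAbove h𝔐
  set 𝔓' := 𝔓.comap (absIntegersMap ℚ K) with h𝔓'def
  have h𝔓' : 𝔓' ∈ v₁.primesAbove := comap_absIntegersMap_mem_primesAbove hwv₁ h𝔓
  haveI : 𝔓'.IsPrime := h𝔓'.1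
  -- ### a `K`-Frobenius `F` at `𝔓` and a `ℚ`-Frobenius `h'` at `𝔓'`; `res F = j · h'h'` with `j` inert
  obtain ⟨F, hF⟩ := HeightOneSpectrum.exists_isArithFrobAt_of_mem_primesAbove_holds h𝔓
  obtain ⟨h', hh'⟩ := HeightOneSpectrum.exists_isArithFrobAt_of_mem_primesAbove_holds h𝔓'
  have hj := Iso.absGaloisRestrict_mul_inv_sq_mem_inertia K hK.1 hℓp hℓP hw h𝔓 hF hℓv₁ h𝔓' hh'
  -- `j = res F · (h'h')⁻¹ ∈ I_𝔓'` acts trivially on `E[3](ℚ̄)` (good reduction at `ℓ ≠ 3`)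
  have h3v₁ : ((((3 ^ 1 : ℕ) : ℤ)) : 𝓞 ℚ) ∉ v₁.asIdeal := by
    intro h3
    have hcop : Nat.Coprime ℓ 3 := (Nat.coprime_primes hℓp Nat.prime_three).mpr hℓ3
    obtain ⟨a, b, hab⟩ := (Nat.isCoprime_iff_coprime.mpr hcop : IsCoprime (ℓ : ℤ) (3 : ℤ))
    apply v₁.isPrime.ne_top
    rw [Ideal.eq_top_iff_one]
    have h1 : (1 : 𝓞 ℚ) = (a : 𝓞 ℚ) * (ℓ : 𝓞 ℚ) + (b : 𝓞 ℚ) * ((((3 ^ 1 : ℕ) : ℤ)) : 𝓞 ℚ) := by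
      rw [pow_one]
      exact_mod_cast congrArg (fun t : ℤ => (t : 𝓞 ℚ)) hab.symm
    rw [h1]
    exact v₁.asIdeal.add_mem (v₁.asIdeal.mul_mem_left _ hℓv₁) (v₁.asIdeal.mul_mem_left _ h3)
  have hjP : ∀ P : geomTorsion W ((3 ^ 1 : ℕ) : ℤ), (absGaloisRestrict ℚ K F * (h' * h')⁻¹) • P = P :=
    fun P ↦ W.smul_geomTorsion_eq_of_mem_inertia hgood₁ h3v₁ h𝔓' hj P
  -- ### `h'h' = 1` on `E[3](ℚ̄)` (Cayley–Hamilton at the Kolyvagin prime), hence `res F = 1` there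
  have hres : ∀ P : geomTorsion W ((3 ^ 1 : ℕ) : ℤ), absGaloisRestrict ℚ K F • P = P := fun P ↦ by
    have h1 := hjP ((h' * h') • P)
    rw [smul_smul, inv_mul_cancel_right] at h1
    rw [h1, mul_smul]
    exact frob_sq_smul_eq_self W hℓ3 hgood hdvd.1 hdvd.2 hv₁ℓ h𝔓' hh' P
  -- ### transport to `E[3](K̄)`
  refine ⟨F, hF, fun Q ↦ ?_⟩
  obtain ⟨P, rfl⟩ := (RatClosure.torsionEquiv (K := K) W ((3 ^ 1 : ℕ) : ℤ)).surjective Q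
  rw [← RatClosure.torsionEquiv_smul, hres]

/-- **§D. The decomposition group `G_{𝔓_{ι₀,𝔐}}` at a Kolyvagin prime fixes `E(K̄)[3]` pointwise** (`λ` splits
completely in `K(E[3])`): `G_𝔓` is generated by the Frobenius of §B, the inertia group (trivial on `E[3]` by good
reduction, `inertia_le_torsionFixing`) and the open subgroup `Γ_{K(E[3])}` (`LocalFrob.smul_eq_self_of_frob_smul_eq_self`).
[cite: GrossLMS1991, §3–§4] [cite: NeukirchANT1999, Ch. I §9 Prop. (9.4)] -/
theorem smul_torsion_eq_self_of_mem_decompositionSubgroup (hK : IsImaginaryQuadratic K) {ℓ : ℕ}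
    (hℓ : Zhang2014.IsKolyvaginPrime (W.conductorNorm ℤ) W K 3 ℓ) (w : HeightOneSpectrum (𝓞 K))
    (hw : (ℓ : 𝓞 K) ∈ w.asIdeal) {𝔐 : Ideal w.localAbsIntegers} (h𝔐 : 𝔐 ∈ w.localPrimesAbove)
    {d : absoluteGaloisGroup K}
    (hd : d ∈ (w.primeBelow (closureEmb (K := K) (w.adicCompletion K)) 𝔐).decompositionSubgroup
      (absoluteGaloisGroup K))
    (Q : geomTorsion (W.baseChange K) ((3 ^ 1 : ℕ) : ℤ)) : d • Q = Q := by
  obtain ⟨F, hF, hFQ⟩ := exists_frobenius_trivial W K hK hℓ w hw h𝔐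
  obtain ⟨hgood, h3w⟩ := hasGoodReductionAt_of_kolyvagin W K hℓ w hw
  have h𝔓 := HeightOneSpectrum.primeBelow_mem_primesAbove (ι := closureEmb (K := K) (w.adicCompletion K)) h𝔐
  have hI := inertia_le_torsionFixing (W.baseChange K) (fun h ↦ h hgood) h3w
    (closureEmb (K := K) (w.adicCompletion K)) h𝔐
  exact LocalFrob.smul_eq_self_of_frob_smul_eq_self (W.baseChange K) h𝔓 (by norm_num) hF hI (hFQ Q) hd

/-- §D as an inclusion: `G_{𝔓_{ι₀,𝔐}} ≤ Γ_{K(E[3])}` (`torsionFixing`). [cite: GrossLMS1991, §3–§4] -/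
theorem decompositionSubgroup_le_torsionFixing (hK : IsImaginaryQuadratic K) {ℓ : ℕ}
    (hℓ : Zhang2014.IsKolyvaginPrime (W.conductorNorm ℤ) W K 3 ℓ) (w : HeightOneSpectrum (𝓞 K))
    (hw : (ℓ : 𝓞 K) ∈ w.asIdeal) {𝔐 : Ideal w.localAbsIntegers} (h𝔐 : 𝔐 ∈ w.localPrimesAbove) :
    (w.primeBelow (closureEmb (K := K) (w.adicCompletion K)) 𝔐).decompositionSubgroup (absoluteGaloisGroup K) ≤
      torsionFixing (W.baseChange K) ((3 ^ 1 : ℕ) : ℤ) :=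
  fun _ hd ↦ (mem_torsionFixing_iff _ _).mpr fun Q ↦
    smul_torsion_eq_self_of_mem_decompositionSubgroup W K hK hℓ w hw h𝔐 hd Q

/-! ## §E The decomposition group at `λ` fixes the embedded Hilbert class field `K[1]` -/

omit [W.IsElliptic] in
/-- **§E. `G_𝔓` fixes `K[1] ⊆ K̄` pointwise, `𝔓` any prime of `\bar ℤ_K` above the place `λ = (ℓ)` of a Kolyvagin
prime** (any `K`-embedding `e₁ : K[1] → K̄`): `λ` is principal and prime to `1`, so splits completely in the Hilbert
class field (`mem_splitPrimes_ringClassField_of_span_natCast`, PROVED class field theory); a Frobenius `F` at `𝔓`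
then fixes `e₁(K[1])` (`smul_algHom_eq_self_of_mem_splitPrimes`), so does `i·F` for every `i` in the inertia group
(again a Frobenius, `isArithFrobAt_mul_iff_of_mem_inertia`), hence every inertia element, and `G_𝔓` is generated by
`F`, the inertia group and the open subgroup `Gal(K̄/e₁(K[1]))`
(`exists_eq_frobenius_pow_mul_of_mem_decompositionSubgroup`). Gross 1991 §3 ∕ McCallum §4: "`λ` splits completely in
`K_1`". [cite: GrossLMS1991, §3 (proof of Prop. 3.7)] [cite: Marcus2018, Ch. 4, remark after Thm. 32] -/
theorem smul_ringClassFieldOne_eq_self_of_mem_decompositionSubgroup (hK : IsImaginaryQuadratic K) (ι : K →+* ℂ)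
    {ℓ : ℕ} (hℓ : Zhang2014.IsKolyvaginPrime (W.conductorNorm ℤ) W K 3 ℓ) (w : HeightOneSpectrum (𝓞 K))
    (hw : (ℓ : 𝓞 K) ∈ w.asIdeal) {𝔓 : Ideal (absIntegers (𝓞 K) K)} (h𝔓 : 𝔓 ∈ w.primesAbove)
    (e₁ : ringClassField K ι 1 →ₐ[K] AlgebraicClosure K) {d : absoluteGaloisGroup K}
    (hd : d ∈ 𝔓.decompositionSubgroup (absoluteGaloisGroup K)) (y : ringClassField K ι 1) :
    d • e₁ y = e₁ y := by
  have hℓp : ℓ.Prime := hℓ.1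
  have hℓP : (Ideal.span {(ℓ : 𝓞 K)}).IsPrime := hℓ.2.2.2.2.1
  haveI := (finiteDimensional_and_isGalois_ringClassField hK ι one_ne_zero).1
  haveI := (finiteDimensional_and_isGalois_ringClassField hK ι one_ne_zero).2
  haveI : NumberField (ringClassField K ι 1) := NumberField.of_module_finite K _
  -- `w = (ℓ)` splits completely in `K[1]`
  have hwℓ : w.asIdeal = Ideal.span {((ℓ : ℕ) : 𝓞 K)} := by
    have hne : Ideal.span {(ℓ : 𝓞 K)} ≠ ⊥ := by
      rw [Ne, Ideal.span_singleton_eq_bot]; exact_mod_cast hℓp.ne_zero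
    exact ((hℓP.isMaximal hne).eq_of_le w.isPrime.ne_top ((Ideal.span_singleton_le_iff_mem _).mpr hw)).symm
  have hsplit : w ∈ splitPrimes K (ringClassField K ι 1) :=
    mem_splitPrimes_ringClassField_of_span_natCast hK ι one_ne_zero hwℓ (Nat.coprime_one_right ℓ)
  -- Frobenius elements at `𝔓` fix `e₁(K[1])`; so do inertia elements (`i = (iF)F⁻¹`)
  obtain ⟨F, hF⟩ := HeightOneSpectrum.exists_isArithFrobAt_of_mem_primesAbove_holds h𝔓
  have hFrob : ∀ {Φ : absoluteGaloisGroup K}, IsArithFrobAt (𝓞 K) Φ 𝔓 → ∀ z, Φ • e₁ z = e₁ z :=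
    fun hΦ z ↦ smul_algHom_eq_self_of_mem_splitPrimes e₁ hsplit h𝔓 hΦ z
  have hIner : ∀ i ∈ 𝔓.inertia (absoluteGaloisGroup K), ∀ z, i • e₁ z = e₁ z := by
    intro i hi z
    have h1 : (i * F) • e₁ z = e₁ z := hFrob ((isArithFrobAt_mul_iff_of_mem_inertia hi).mpr hF) z
    rw [mul_smul, hFrob hF z] at h1
    exact h1
  have hpow : ∀ (n : ℕ) z, (F ^ n) • e₁ z = e₁ z := by
    intro n z
    induction n with
    | zero => rw [pow_zero, one_smul]
    | succ n ih => rw [pow_succ, mul_smul, hFrob hF z, ih]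
  -- the open subgroup fixing `e₁(K[1])`
  haveI : FiniteDimensional K e₁.fieldRange :=
    LinearEquiv.finiteDimensional (AlgEquiv.ofInjectiveField e₁).toLinearEquiv
  let U : Subgroup (absoluteGaloisGroup K) := e₁.fieldRange.fixingSubgroup
  have hU : IsOpen (U : Set (absoluteGaloisGroup K)) := IntermediateField.fixingSubgroup_isOpen e₁.fieldRange
  obtain ⟨n, i, u, hi, hu, rfl⟩ := exists_eq_frobenius_pow_mul_of_mem_decompositionSubgroup h𝔓 hF hU hd
  have huz : u • e₁ y = e₁ y := by
    have hy : e₁ y ∈ e₁.fieldRange := ⟨y, rfl⟩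
    exact (mem_fixingSubgroup_iff_forall_smul e₁.fieldRange u).mp hu ⟨e₁ y, hy⟩
  rw [mul_smul, mul_smul, huz, hIner i hi, hpow]

end Local

end Summit.BirchSwinnertonDyer.Rank1Residual.X11b.Three.Koly.Method2.KolyLocal

end
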